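import Summits.ResolutionOfSingularities.ResolutionOfSingularities.Theorems.PurelyInseparableDim4AtlasShapeChartMem
import Summits.ResolutionOfSingularities.ResolutionOfSingularities.Theorems.PurelyInseparableDim4ChartAtlasGlue
import Summits.ResolutionOfSingularities.ResolutionOfSingularities.Theorems.PurelyInseparableDim4ChartZigzagBoundary
import Literature.AlgebraicGeometry.Resolution.NormalCrossingsLocal
import Literature.AlgebraicGeometry.Resolution.IdealSheafDescent
import HarnessLib

/-!
# Purely inseparable four-folds: an ATLAS CHILD is REGULAR and has SIMPLE NORMAL CROSSINGS with the transformed boundary — chartwise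
# readings glued (brick S3 (c) v4, tranche 1, brick A1-admissible; cell `res-dim4-pi`)

[OURS · counted 0] (D-0157 DOOR 2; host item stmt-ResolutionOfSingularities-16155, helper). Nothing here proves resolution of
singularities in dimension ≥ 4 / characteristic `p`. Step (5) of the A1 architecture (`res-dim4-typ-3/S3c-V4-ATLAS-MEMBERS-DESIGN.md` §10):
in v3's zigzag setting (`Z ←φ— Y —ψ→ 𝔸⁵`, `π : W → Z` the blow-up along `Zc`, model blow-up `B` of `V(z, x_S)`, comparison `ε` over `Y`),
a closed `c″ ⊆ W` COVERED by the zigzag charts of finitely many translated model charts `m ∈ Pc ⊆ S` (re-centrings `Θ_m`, translation `b`,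
`b|_S = 0`) and READING `𝓘Λ(T_m)` (`m ∈ T_m`) on chart `m` is a regular subscheme and has simple normal crossings with the transformed
boundary, provided the parent's boundary is snc with `Zc` and has v3's translated-hyperplane dictionary along the parent's reading region.
Chartwise: `V(ψ″^* 𝓘Λ)` is regular (`ChartDictionary.isRegular_subscheme_comap_𝓘Λ`) and snc with the propagated dictionary
(A1h `shapeT_transform_zigzag_of_chart_mem` + `ChartDictionary.hasSNCWith_comap_of_shapeT_zigzag`); glue by typ-2's `…ChartAtlasGlue`.
typ-2's global snc theorem for escaping centres (shears, `|B| ≤ 1`) is NOT needed in tranche 1.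

* **`isRegular_and_hasSNCWith_of_chart_readings`**. AI-produced formalisation, weaker than expert review.
bears_on: LADDER-RESOLUTION:D157-DOOR2 (res-dim4-pi · S3 (c) v4 A1-admissible).
-/

set_option linter.dupNamespace false -- D-0017: single-problem summit path `Summit.<S>.<S>.…` by design

noncomputable section

open MvPolynomial Finset CategoryTheory AlgebraicGeometry Opposite TopologicalSpace
open AlgebraicGeometry.Scheme.IdealSheafData (ofIdealTop vanishingIdeal)

namespace Summit.ResolutionOfSingularities.ResolutionOfSingularities.Theorems.PIDim4

open Literature.AlgebraicGeometry.Resolution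
open Literature.AlgebraicGeometry.Resolution.AffinePointBlowup (P A γ coord Wtop ξ)

namespace Equimultiple

section ChildRegularSNC

variable {K : Type} [Field K] {Z Y W Bl : Scheme.{0}} (φ : Y ⟶ Z) [IsOpenImmersion φ] (ψ : Y ⟶ P 4 K) [IsOpenImmersion ψ]
  {π : W ⟶ Z} {B : Bl ⟶ P 4 K} {S : Finset (Fin 4)}
  (ε : (π ⁻¹ᵁ φ.opensRange : Scheme.{0}) ≅ (B ⁻¹ᵁ ψ.opensRange : Scheme.{0}))

/-- **AN ATLAS CHILD IS REGULAR AND SNC WITH THE TRANSFORMED BOUNDARY.** See the module docstring.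
[cite: BierstoneGrigorievMilmanWlodarczyk2011, Def. 3.1.3 (1)–(2)] [cite: Hauser2010, §G] -/
theorem isRegular_and_hasSNCWith_of_chart_readings [IsLocallyNoetherian Z] (Zc : Z.IdealSheafData) (hπ : IsBlowup π Zc)
    (hB : IsBlowup B (AffineCoordBlowup.𝓘Λ 4 K (insert 0 (Fin.succ '' (S : Set (Fin 4))))))
    (hsq : ε.hom ≫ (B ∣_ ψ.opensRange) = (π ∣_ φ.opensRange) ≫ (φ.isoOpensRange.inv ≫ ψ.isoOpensRange.hom))
    (hC' : ((AffineCoordBlowup.𝓘Λ 4 K (insert 0 (Fin.succ '' (S : Set (Fin 4))))).comap ψ.opensRange.ι).comap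
        (φ.isoOpensRange.inv ≫ ψ.isoOpensRange.hom) = Zc.comap φ.opensRange.ι)
    (M : MarkedIdeal Z) (hsncZ : HasSNCWith M.boundary Zc) (idx : Z.IdealSheafData → Fin 4) (cst : Z.IdealSheafData → K)
    (hshape : ∀ D ∈ M.boundary, ((D.support : Set Z) ∩ φ '' (ψ ⁻¹'
        (AffineCoordBlowup.CΛ 4 K (insert 0 (Fin.succ '' (S : Set (Fin 4)))) : Set (P 4 K)))).Nonempty →
      D.comap φ = (ofIdealTop (Ideal.span {(γ 4 K).symm (X (idx D).succ + C (cst D))})).comap ψ ∧ (idx D ∈ S → cst D = 0))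
    (hinj : ∀ D₁ ∈ M.boundary, ∀ D₂ ∈ M.boundary,
      ((D₁.support : Set Z) ∩ φ '' (ψ ⁻¹' (AffineCoordBlowup.CΛ 4 K (insert 0 (Fin.succ '' (S : Set (Fin 4)))) : Set (P 4 K)))).Nonempty →
      ((D₂.support : Set Z) ∩ φ '' (ψ ⁻¹' (AffineCoordBlowup.CΛ 4 K (insert 0 (Fin.succ '' (S : Set (Fin 4)))) : Set (P 4 K)))).Nonempty →
      idx D₁ = idx D₂ → D₁ = D₂)
    (Pc : Finset (Fin 4)) (hPc : ∀ m ∈ Pc, m ∈ S) (Θ : Fin 4 → (A 4 K ≃ₐ[K] A 4 K)) {b : Fin 4 → K}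
    (hΘ : ∀ m ∈ Pc, ∀ i : Fin 4, Θ m (X i.succ) = X i.succ + C (b i)) (hbS : ∀ i ∈ S, b i = 0)
    (Tm : Fin 4 → Finset (Fin 4)) (hTm : ∀ m ∈ Pc, m ∈ Tm m) (c'' : Closeds W)
    (hcov : (c'' : Set W) ⊆ ⋃ (m : Fin 4) (hm : m ∈ Pc),
      Set.range (((Spec.map (CommRingCat.ofHom (Θ m : A 4 K →+* A 4 K)) ≫
          AffineCoordBlowup.chartImm hB (ChartDictionary.succ_mem_centreVars (hPc m hm))) ∣_ (B ⁻¹ᵁ ψ.opensRange)) ≫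
        ε.inv ≫ (π ⁻¹ᵁ φ.opensRange).ι))
    (hread : ∀ (m : Fin 4) (hm : m ∈ Pc),
      (vanishingIdeal c'').comap
          (((Spec.map (CommRingCat.ofHom (Θ m : A 4 K →+* A 4 K)) ≫
              AffineCoordBlowup.chartImm hB (ChartDictionary.succ_mem_centreVars (hPc m hm))) ∣_ (B ⁻¹ᵁ ψ.opensRange)) ≫
            ε.inv ≫ (π ⁻¹ᵁ φ.opensRange).ι) =
        (AffineCoordBlowup.𝓘Λ 4 K (insert 0 (Fin.succ '' (Tm m : Set (Fin 4))))).comap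
          ((Spec.map (CommRingCat.ofHom (Θ m : A 4 K →+* A 4 K)) ≫
              AffineCoordBlowup.chartImm hB (ChartDictionary.succ_mem_centreVars (hPc m hm))) ⁻¹ᵁ (B ⁻¹ᵁ ψ.opensRange)).ι) :
    Scheme.IsRegular (vanishingIdeal c'').subscheme ∧ HasSNCWith (M.transform π Zc).boundary (vanishingIdeal c'') := by
  classical
  haveI : IsProper π := hπ.isProper
  haveI : IsLocallyNoetherian W := LocallyOfFiniteType.isLocallyNoetherian π
  haveI : IsProper B := hB.isProper
  haveI : IsLocallyNoetherian Bl := LocallyOfFiniteType.isLocallyNoetherian B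
  -- the family of zigzag charts of the charts, indexed by `↥Pc`
  let φ₀ : ∀ i : ↥Pc, P 4 K ⟶ Bl := fun i =>
    Spec.map (CommRingCat.ofHom (Θ i.1 : A 4 K →+* A 4 K)) ≫ AffineCoordBlowup.chartImm hB (ChartDictionary.succ_mem_centreVars (hPc i.1 i.2))
  let U : ↥Pc → Scheme.{0} := fun i => ((φ₀ i) ⁻¹ᵁ (B ⁻¹ᵁ ψ.opensRange) : Scheme.{0})
  let φf : ∀ i : ↥Pc, U i ⟶ W := fun i => ((φ₀ i) ∣_ (B ⁻¹ᵁ ψ.opensRange)) ≫ ε.inv ≫ (π ⁻¹ᵁ φ.opensRange).ι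
  let ψf : ∀ i : ↥Pc, U i ⟶ P 4 K := fun i => ((φ₀ i) ⁻¹ᵁ (B ⁻¹ᵁ ψ.opensRange)).ι
  haveI hφ₀ : ∀ i : ↥Pc, IsOpenImmersion (φ₀ i) := fun i => by
    haveI := isOpenImmersion_specMap_algEquiv (Θ i.1)
    change IsOpenImmersion (Spec.map (CommRingCat.ofHom (Θ i.1 : A 4 K →+* A 4 K)) ≫ _)
    infer_instance
  haveI hφf : ∀ i : ↥Pc, IsOpenImmersion (φf i) := fun i => by
    change IsOpenImmersion (((φ₀ i) ∣_ (B ⁻¹ᵁ ψ.opensRange)) ≫ ε.inv ≫ (π ⁻¹ᵁ φ.opensRange).ι)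
    infer_instance
  haveI hψf : ∀ i : ↥Pc, IsOpenImmersion (ψf i) := fun i => by
    change IsOpenImmersion ((φ₀ i) ⁻¹ᵁ (B ⁻¹ᵁ ψ.opensRange)).ι
    infer_instance
  -- the cover of `V(𝓘(c″))` by the family
  have hcov' : (((vanishingIdeal c'').support : Set W)) ⊆ ⋃ i : ↥Pc, Set.range (φf i) := by
    rw [Scheme.IdealSheafData.coe_support_vanishingIdeal]
    intro w hw
    obtain ⟨m, hm, hwm⟩ := Set.mem_iUnion₂.mp (hcov hw)
    exact Set.mem_iUnion.mpr ⟨⟨m, hm⟩, hwm⟩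
  -- the readings, per index
  have hread' : ∀ i : ↥Pc, (vanishingIdeal c'').comap (φf i) =
      (AffineCoordBlowup.𝓘Λ 4 K (insert 0 (Fin.succ '' (Tm i.1 : Set (Fin 4))))).comap (ψf i) := fun i => hread i.1 i.2
  refine ⟨?_, ?_⟩
  · -- regular
    refine ChartDictionary.isRegular_subscheme_of_cover_comap φf hcov' fun i => ?_
    rw [hread' i]
    exact ChartDictionary.isRegular_subscheme_comap_𝓘Λ (ψf i) _
  · -- simple normal crossings with the transformed boundary
    have hE₂ : HasSNC (M.transform π Zc).boundary := MarkedIdeal.hasSNC_transform_boundary M hsncZ hπ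
    refine ChartDictionary.hasSNCWith_of_cover_comap φf hE₂ hcov' fun i => ?_
    obtain ⟨idx₂, cst₂, hshape₂, hinj₂⟩ :=
      shapeT_transform_zigzag_of_chart_mem φ ψ ε Zc hB hsq hC' (hPc i.1 i.2) (hbS i.1 (hPc i.1 i.2)) (hΘ i.1 i.2) (hTm i.1 i.2)
        idx cst hshape hinj
    have hEc₂ := ChartDictionary.hasSNCWith_comap_of_shapeT_zigzag (φf i) (ψf i) hE₂ idx₂ cst₂ hshape₂ hinj₂
    rw [hread' i]
    exact hEc₂

end ChildRegularSNC

end Equimultiple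

end Summit.ResolutionOfSingularities.ResolutionOfSingularities.Theorems.PIDim4

end
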